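import Mathlib.Analysis.Real.Cardinality
import Mathlib.LinearAlgebra.Matrix.BilinearForm
import Mathlib.LinearAlgebra.Matrix.ToLinearEquiv
import Mathlib.NumberTheory.Transcendental.Liouville.LiouvilleNumber
import Mathlib.Tactic.Module
import Literature.AlgebraicGeometry.Surfaces.K3TwistorLines
import HarnessLib

/-!
# Crux `NikulinTwinTransport.TwinTwistorTransport` (stmt-HodgeConjecture-14393), line
# `mukai-lift-full-similitude`, stub `TwistorReach` — part B: twistor-line connectivity of the
# period domain of an arbitrary non-degenerate integral lattice with a positive three-space

Huybrechts, *Lectures on K3 Surfaces*, Ch. 7 §3.1: "For the following, `Λ` can be any lattice of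
signature `(3, b−3)`. […] **Proposition 3.2** Any two points `x, y ∈ D` are equivalent" (joined by
a finite chain of GENERIC twistor lines `T_W = D ∩ ℙ(W_ℂ)`, `W ⊂ Λ_ℝ` a positive three-space with
`W^⊥ ∩ Λ = 0`, Def. 3.1). The tree's `K3TwistorLines` proves this for `Λ_{K3}`; here the SAME
proof (Beauville's chain of three twistor lines through a generic vector, linear algebra only) is
run for an arbitrary integral lattice `Λ = ℤ^ι` with Gram matrix `G` (symmetric, `det G ≠ 0`)
possessing a positive triple — in fact only `n₊ ≥ 3` and non-degeneracy are used, never `n₊ = 3`.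
The complex form is `(a.b) = Σ aᵢ Gᵢⱼ bⱼ` on `Λ_ℂ = ι → ℂ`, the real form Mathlib's
`Matrix.toBilin' (G.map Int.cast)`; period points, positive / generic three-spaces and twistor
lines are spelled out inline (local notations, no new definitions), in the shapes of
`K3TwistorLines` (`k3PeriodDomain`, `IsPositiveThreeSpace`, `IsGenericThreeSpace`,
`k3TwistorLine`, `OnCommonGenericTwistorLine`).

Main result: `lattice_periodDomain_twistorConnected` (registered sub-goal of the crux item).
Part A (`…TwistorReachAlgebra`: `twistorV_*`) supplies the bilinear algebra; part C transports
the result to the Mukai-lift lattice `Λ_{K3} ⊕ ⟨−2⟩` (stub `TwistorReach`).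

References: [Huybrechts2016K3] Ch. 6 §1.1, Prop. 1.5; Ch. 7 §3.1 Def. 3.1, Prop. 3.2.
-/

-- `Summit.HodgeConjecture.HodgeConjecture.…` (summit = problem) duplicates a namespace component by design (D-0017).
set_option linter.dupNamespace false

noncomputable section

namespace Summit.HodgeConjecture.HodgeConjecture.Theorems.TwinTwistorTransport.MukaiLift

open scoped BigOperators

variable {ι : Type} [Fintype ι] [DecidableEq ι]

/-- The complex bilinear form `(a.b) = Σᵢⱼ aᵢ Gᵢⱼ bⱼ` of the Gram matrix `G` on `Λ_ℂ = ι → ℂ`. -/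
local notation3 (prettyPrint := false) "CF[" G "](" a ", " b ")" =>
  ∑ i, ∑ j, (a : _ → ℂ) i * (((G : Matrix _ _ ℤ) i j : ℤ) : ℂ) * (b : _ → ℂ) j

/-- The real bilinear form of `G` on `Λ_ℝ = ι → ℝ` (Mathlib's `Matrix.toBilin'`). -/
local notation3 (prettyPrint := false) "RB[" G "]" =>
  Matrix.toBilin' (Matrix.map (G : Matrix _ _ ℤ) (Int.cast : ℤ → ℝ))

/-! ### The real form: unfolding, symmetry, comparison with the complex form -/

/-- The real form is the double sum `Σᵢⱼ uᵢ Gᵢⱼ wⱼ`. [folklore] -/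
theorem latticeRB_apply (G : Matrix ι ι ℤ) (u w : ι → ℝ) :
    RB[G] u w = ∑ i, ∑ j, u i * (G i j : ℝ) * w j := by
  rw [Matrix.toBilin'_apply]
  rfl

/-- The real form of a symmetric Gram matrix is symmetric. [folklore] -/
theorem latticeRB_comm (G : Matrix ι ι ℤ) (hG : ∀ i j, G i j = G j i) (u w : ι → ℝ) :
    RB[G] u w = RB[G] w u := by
  rw [latticeRB_apply, latticeRB_apply, Finset.sum_comm]
  refine Finset.sum_congr rfl fun i _ => Finset.sum_congr rfl fun j _ => ?_
  rw [hG j i]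
  ring

/-- On real vectors the complex form is the real form. [folklore] -/
theorem latticeCF_ofReal (G : Matrix ι ι ℤ) (u w : ι → ℝ) :
    CF[G](fun i => (u i : ℂ), fun i => (w i : ℂ)) = ((RB[G] u w : ℝ) : ℂ) := by
  rw [latticeRB_apply]
  push_cast
  rfl

/-- Real part of the complex form on real vectors. [folklore] -/
theorem latticeCF_ofReal_re (G : Matrix ι ι ℤ) (u w : ι → ℝ) :
    (CF[G](fun i => (u i : ℂ), fun i => (w i : ℂ))).re = RB[G] u w := by
  rw [latticeCF_ofReal, Complex.ofReal_re]

/-- The complex form of a lattice vector against a real vector is the real form. [folklore] -/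
theorem latticeCF_intCast_ofReal (G : Matrix ι ι ℤ) (v : ι → ℤ) (w : ι → ℝ) :
    CF[G](fun i => ((v i : ℤ) : ℂ), fun i => (w i : ℂ)) =
      ((RB[G] (fun i => (v i : ℝ)) w : ℝ) : ℂ) := by
  rw [← latticeCF_ofReal]
  push_cast
  rfl

omit [DecidableEq ι] in
/-- Symmetry of the complex form. [folklore] -/
theorem latticeCF_comm (G : Matrix ι ι ℤ) (hG : ∀ i j, G i j = G j i) (a b : ι → ℂ) :
    CF[G](a, b) = CF[G](b, a) := by
  rw [Finset.sum_comm]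
  refine Finset.sum_congr rfl fun i _ => Finset.sum_congr rfl fun j _ => ?_
  rw [hG j i]
  ring

omit [DecidableEq ι] in
/-- Additivity of the complex form in the first variable. [folklore] -/
theorem latticeCF_add_left (G : Matrix ι ι ℤ) (a a' b : ι → ℂ) :
    CF[G](a + a', b) = CF[G](a, b) + CF[G](a', b) := by
  simp only [Pi.add_apply, add_mul, Finset.sum_add_distrib]

omit [DecidableEq ι] in
/-- Homogeneity of the complex form in the first variable. [folklore] -/
theorem latticeCF_smul_left (G : Matrix ι ι ℤ) (t : ℂ) (a b : ι → ℂ) :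
    CF[G](t • a, b) = t * CF[G](a, b) := by
  simp only [Pi.smul_apply, smul_eq_mul, Finset.mul_sum, mul_assoc]

omit [DecidableEq ι] in
/-- Additivity of the complex form in the second variable. [folklore] -/
theorem latticeCF_add_right (G : Matrix ι ι ℤ) (a b b' : ι → ℂ) :
    CF[G](a, b + b') = CF[G](a, b) + CF[G](a, b') := by
  simp only [Pi.add_apply, mul_add, Finset.sum_add_distrib]

omit [DecidableEq ι] in
/-- Homogeneity of the complex form in the second variable. [folklore] -/
theorem latticeCF_smul_right (G : Matrix ι ι ℤ) (t : ℂ) (a b : ι → ℂ) :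
    CF[G](a, t • b) = t * CF[G](a, b) := by
  simp only [Pi.smul_apply, smul_eq_mul, Finset.mul_sum]
  refine Finset.sum_congr rfl fun i _ => Finset.sum_congr rfl fun j _ => ?_
  ring

/-! ### Period points of `Λ_ℂ` as conformal orthogonal pairs of positive real vectors
(Huybrechts Ch. 6 Prop. 1.5) -/

/-- **A vector `x ∈ Λ_ℂ` is a period point (`(x.x) = 0`, `(x̄.x) > 0`) iff `(Re x . Im x) = 0`,
`(Re x)² = (Im x)²` and `(Re x)² > 0`** — for the symmetric integral Gram matrix `G`.
[cite: Huybrechts2016K3, Ch. 6 Prop. 1.5] -/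
theorem latticePeriod_iff_re_im (G : Matrix ι ι ℤ) (hG : ∀ i j, G i j = G j i) (x : ι → ℂ) :
    (CF[G](x, x) = 0 ∧ 0 < (CF[G](star x, x)).re) ↔
      (RB[G] (fun i => (x i).re) (fun i => (x i).im) = 0 ∧
        RB[G] (fun i => (x i).re) (fun i => (x i).re) = RB[G] (fun i => (x i).im) (fun i => (x i).im) ∧
        0 < RB[G] (fun i => (x i).re) (fun i => (x i).re)) := by
  set a : ι → ℂ := fun i => ((x i).re : ℂ) with ha
  set b : ι → ℂ := fun i => ((x i).im : ℂ) with hb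
  set A : ℝ := RB[G] (fun i => (x i).re) (fun i => (x i).re) with hA
  set Bv : ℝ := RB[G] (fun i => (x i).im) (fun i => (x i).im) with hB
  set C : ℝ := RB[G] (fun i => (x i).re) (fun i => (x i).im) with hC
  have hAA : CF[G](a, a) = (A : ℂ) := latticeCF_ofReal G _ _
  have hBB : CF[G](b, b) = (Bv : ℂ) := latticeCF_ofReal G _ _
  have hCC : CF[G](a, b) = (C : ℂ) := latticeCF_ofReal G _ _
  have hCC' : CF[G](b, a) = (C : ℂ) := by rw [latticeCF_comm G hG, hCC]
  have hx : x = a + Complex.I • b := by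
    funext i
    apply Complex.ext <;> simp [a, b]
  have hsx : star x = a + (-Complex.I) • b := by
    funext i
    apply Complex.ext <;> simp [a, b]
  have h1 : CF[G](x, x) = (A : ℂ) - (Bv : ℂ) + 2 * Complex.I * (C : ℂ) := by
    rw [hx, latticeCF_add_left, latticeCF_add_right, latticeCF_add_right, latticeCF_smul_left,
      latticeCF_smul_left, latticeCF_smul_right, latticeCF_smul_right, hAA, hBB, hCC, hCC']
    ring_nf
    rw [Complex.I_sq]
    ring
  have h2 : CF[G](star x, x) = (A : ℂ) + (Bv : ℂ) := by
    rw [hsx, hx, latticeCF_add_left, latticeCF_add_right, latticeCF_add_right,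
      latticeCF_smul_left, latticeCF_smul_left, latticeCF_smul_right, latticeCF_smul_right,
      hAA, hBB, hCC, hCC']
    ring_nf
    rw [Complex.I_sq]
    ring
  rw [h1, h2]
  constructor
  · rintro ⟨hxx, hpos⟩
    have hre := congrArg Complex.re hxx
    have him := congrArg Complex.im hxx
    simp at hre him hpos
    exact ⟨him, by linarith, by linarith⟩
  · rintro ⟨hC0, hAB, hA0⟩
    refine ⟨?_, ?_⟩
    · rw [hC0, hAB]
      push_cast
      ring
    · simp only [Complex.add_re, Complex.ofReal_re]
      linarith

/-- The period point `u + i w` of a conformal orthogonal pair `(u, w)` of positive real vectors.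
[cite: Huybrechts2016K3, Ch. 6 Prop. 1.5] -/
theorem latticePeriod_mk_mem (G : Matrix ι ι ℤ) (hG : ∀ i j, G i j = G j i) {u w : ι → ℝ}
    (huw : RB[G] u w = 0) (huu : RB[G] u u = RB[G] w w) (hu : 0 < RB[G] u u) :
    (CF[G]((fun i => (⟨u i, w i⟩ : ℂ)), (fun i => (⟨u i, w i⟩ : ℂ))) = 0 ∧
      0 < (CF[G](star (fun i => (⟨u i, w i⟩ : ℂ)), (fun i => (⟨u i, w i⟩ : ℂ)))).re) := by
  rw [latticePeriod_iff_re_im G hG]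
  exact ⟨huw, huu, hu⟩

/-- Every orthogonal pair `u ⊥ w` of positive vectors gives a period point `u + i s w`,
`s = √((u.u)/(w.w))`. [cite: Huybrechts2016K3, Ch. 6 Prop. 1.5] -/
theorem exists_latticePeriod_re_im (G : Matrix ι ι ℤ) (hG : ∀ i j, G i j = G j i) {u w : ι → ℝ}
    (huw : RB[G] u w = 0) (hu : 0 < RB[G] u u) (hw : 0 < RB[G] w w) :
    ∃ s : ℝ, (CF[G]((fun i => (⟨u i, (s • w) i⟩ : ℂ)), (fun i => (⟨u i, (s • w) i⟩ : ℂ))) = 0 ∧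
      0 < (CF[G](star (fun i => (⟨u i, (s • w) i⟩ : ℂ)), (fun i => (⟨u i, (s • w) i⟩ : ℂ)))).re) := by
  refine ⟨Real.sqrt (RB[G] u u / RB[G] w w), latticePeriod_mk_mem G hG ?_ ?_ hu⟩
  · rw [LinearMap.BilinForm.smul_right, huw, mul_zero]
  · rw [LinearMap.BilinForm.smul_left, LinearMap.BilinForm.smul_right, ← mul_assoc,
      Real.mul_self_sqrt (div_nonneg hu.le hw.le), div_mul_cancel₀ _ hw.ne']

/-! ### A vector `g₀` with `g₀^⊥ ∩ Λ = 0` for a non-degenerate integral lattice -/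

/-- **Existence of a real vector with no non-zero lattice vector orthogonal to it**, for any
integral Gram matrix with `det G ≠ 0`: with `L` a Liouville (hence transcendental) number and an
enumeration `e` of `ι`, `g₀ = (L^{e(j)})_j` works — `(v.g₀) = Σⱼ (vG)ⱼ L^{e(j)}` is a non-zero
integer polynomial in `L` as soon as `v ≠ 0`. [cite: Huybrechts2016K3, Ch. 7 §3.1 (generic vectors `w^⊥ ∩ Λ = 0`)] -/
theorem exists_lattice_genericVector (G : Matrix ι ι ℤ) (hdet : G.det ≠ 0) :
    ∃ g : ι → ℝ, ∀ v : ι → ℤ, RB[G] (fun i => (v i : ℝ)) g = 0 → v = 0 := by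
  classical
  have hLt : Transcendental ℤ (liouvilleNumber 2) := transcendental_liouvilleNumber le_rfl
  set L : ℝ := liouvilleNumber 2 with hL
  set e := Fintype.equivFin ι with he
  refine ⟨fun j => L ^ (e j : ℕ), fun v hv => ?_⟩
  by_contra hne
  have hc : Matrix.vecMul v G ≠ 0 := by
    intro hc0
    have hnot : ¬ ∃ w ≠ 0, Matrix.vecMul w G = 0 := by
      rw [Matrix.exists_vecMul_eq_zero_iff]
      exact hdet
    exact hnot ⟨v, hne, hc0⟩
  obtain ⟨j₀, hj₀⟩ := Function.ne_iff.1 hc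
  set p : Polynomial ℤ := ∑ j, Polynomial.monomial (e j : ℕ) (Matrix.vecMul v G j) with hp
  have hp0 : p ≠ 0 := by
    intro h0
    have h := congrArg (fun q : Polynomial ℤ => q.coeff (e j₀ : ℕ)) h0
    simp only [hp, Polynomial.finsetSum_coeff, Polynomial.coeff_monomial, Fin.val_inj,
      EmbeddingLike.apply_eq_iff_eq, Polynomial.coeff_zero, Finset.sum_ite_eq',
      Finset.mem_univ, if_true] at h
    exact hj₀ h
  have heval : Polynomial.aeval L p = RB[G] (fun i => (v i : ℝ)) (fun j => L ^ (e j : ℕ)) := by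
    rw [latticeRB_apply, Finset.sum_comm]
    simp only [hp, map_sum, Polynomial.aeval_monomial, algebraMap_int_eq, eq_intCast,
      Matrix.vecMul, dotProduct, Int.cast_mul]
  exact hLt ⟨p, hp0, heval.trans hv⟩

/-- **Registered sub-goal `latticeGenericVector` (closed form of `exists_lattice_genericVector`)**:
every non-degenerate integral lattice `ℤ^ι` (Gram matrix `G`, `det G ≠ 0`) has a real vector `g`
with `g^⊥ ∩ Λ = 0`. [cite: Huybrechts2016K3, Ch. 7 §3.1] -/
theorem latticeGenericVector : ∀ {ι : Type} [Fintype ι] [DecidableEq ι] (G : Matrix ι ι ℤ), G.det ≠ 0 → ∃ g : ι → ℝ, ∀ v : ι → ℤ, Matrix.toBilin' (Matrix.map G (Int.cast : ℤ → ℝ)) (fun i => (v i : ℝ)) g = 0 → v = 0 :=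
  fun G hdet => exists_lattice_genericVector G hdet

end Summit.HodgeConjecture.HodgeConjecture.Theorems.TwinTwistorTransport.MukaiLift

end
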